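import Literature.AlgebraicGeometry.Deformation.SmoothSchemeLiftObstructionCriterionGlueCharts
import Literature.AlgebraicGeometry.Deformation.SmoothAffineDeformationsPrincipalRestriction
import HarnessLib

/-!
# Gluing the lifted charts, I-bis: the chart ring maps over principal opens are bijective
# (`R ⊗_k Γ(D(f)) = (R ⊗_k Γ(V₀))_{1 ⊗ f} = Γ(Spec (R ⊗_k Γ(V₀)), D(1 ⊗ f))`)

Layer `Literature/AlgebraicGeometry/Deformation` (cell `hodgecm-mathlib`, F-11 sub-line `F11SmoothRoadA`, α1 grandchild
`F11LiftWithLineBundle`, junction D0∕S7 (J1); THEOREMS ONLY — no definition, no instance, no notation, no named fact).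
Sequel of ★ `Deformation/SmoothSchemeLiftObstructionCriterionGlueCharts` (§D: for the chart `p : Spec (R ⊗_k Γ(V₀)) → X` of
a trivial deformation of an affine open `V₀` of the closed fibre and an open `O` of the chart over `V ⊆ V₀`, the chart ring
map `Λ_{O,V} : R ⊗_k Γ(V) → Γ(O)` EXISTS and is unique, characterised by `Λ (r ⊗ 1) = r|_O`, `Λ (1 ⊗ c) = (p^* c)|_O`),
in its `variable`s VERBATIM.

* `preimage_basicOpen_chart` — over a PRINCIPAL open `V = D(f) ⊆ V₀` the relevant open of the chart is the principal open
  `p⁻¹ V = D(1 ⊗ f)` of `Spec (R ⊗_k Γ(V₀))`;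
* `chartRingHom_comp_map` — `Λ_{O,V} ∘ (a ⊗ s ↦ a ⊗ s|_V) = (x ↦ x|_O)` on `R ⊗_k Γ(V₀)`;
* **`chartRingHom_bijective`** — for `O = p⁻¹ V`, `Λ_{O,V}` is BIJECTIVE: source and target are both localizations of
  `R ⊗_k Γ(V₀)` at `1 ⊗ f` (★ `SmoothAffineDeformation.isLocalization_baseChange` = Mathlib
  `IsLocalization.tensorProduct_tensorProduct_right`, and Mathlib `Γ_restrict_isLocalization` for the principal open of the
  affine chart), and `Λ` intertwines the two structure maps, so the universal property of localization gives
  injectivity and surjectivity element by element.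

The gluing files (`…GlueTransition`, `…GlueCocycle`, `…GlueDatum`, `…GlueLineBundleCocycle`) only use that `Λ` is a ring map;
bijectivity is what the CONVERSE direction «a module framed on the chart images of the glued deformation ↦ transition units in
`R ⊗_k Γ(U j ∩ U l)`» (`…GlueLineBundleConverse`) needs.  [AtiyahMacdonald1969] Prop. 3.5 / 3.7 (localization commutes with
tensor product); [Hartshorne1977] II Prop. 2.2 (b) (`Γ(D(f)) = A_f`); [GortzWedhorn2020] Prop. 4.20 (`Spec A ×_S Spec B = Spec (A ⊗ B)`).
HC_CM is proved only modulo the 7 printed citations until rung 0 closes — nothing here bears on a summit statement.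

## References
* [AtiyahMacdonald1969] M. F. Atiyah, I. G. Macdonald, *Introduction to Commutative Algebra* (1969), Ch. 3, Prop. 3.5 and 3.7.
* [Hartshorne1977] R. Hartshorne, *Algebraic Geometry*, GTM 52 (1977), II Prop. 2.2 (b) (p. 71).
* [GortzWedhorn2020] U. Görtz, T. Wedhorn, *Algebraic Geometry I*, 2nd ed. (2020), Prop. 4.20.
* [Hartshorne2010] R. Hartshorne, *Deformation Theory*, GTM 257 (2010), Thm. 10.2 (a) proof (p. 81) — the chart context.
-/

noncomputable section

-- `TopCat.Presheaf`/`TopCat.Sheaf` are not reducible (as in Mathlib's `AlgebraicGeometry/Modules`).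
set_option backward.isDefEq.respectTransparency false

open CategoryTheory AlgebraicGeometry Opposite TopologicalSpace
open scoped TensorProduct

universe u

namespace Literature.AlgebraicGeometry.Deformation

open Literature.AlgebraicGeometry.Motives

variable {k : Type u} [Field k] {X : Over (Spec (CommRingCat.of k))}
  [instΓ : ∀ W : X.left.Opens, Algebra k Γ(X.left, W)]
  (halg : ∀ (W : X.left.Opens) (s : k), algebraMap k Γ(X.left, W) s = (constToPresheaf X).app (op W) s)
  {R : Type u} [CommRing R] [Algebra k R]
  {V₀ : X.left.Opens} (hV₀ : IsAffineOpen V₀)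
  (p : Spec (CommRingCat.of (R ⊗[k] Γ(X.left, V₀))) ⟶ X.left)
  (hp : p = Spec.map (CommRingCat.ofHom
    (Algebra.TensorProduct.includeRight (R := k) (A := R) (B := Γ(X.left, V₀))).toRingHom) ≫ hV₀.fromSpec)

/-! ## §1 The open of the chart over a principal open is principal -/

include hp in
/-- **`p⁻¹ D(f) = D(1 ⊗ f)`**: over the principal open `V = D(f)` of `V₀` the chart has the principal open of
`Spec (R ⊗_k Γ(V₀))` cut out by `1 ⊗ f`. [cite: Hartshorne1977, II Prop. 2.2 (b) (p. 71)] [cite: GortzWedhorn2020, Prop. 4.20] -/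
theorem preimage_basicOpen_chart (f : Γ(X.left, V₀)) :
    p ⁻¹ᵁ X.left.basicOpen f = (Spec (CommRingCat.of (R ⊗[k] Γ(X.left, V₀)))).basicOpen
      ((Scheme.ΓSpecIso (CommRingCat.of (R ⊗[k] Γ(X.left, V₀)))).inv ((1 : R) ⊗ₜ f)) := by
  have hpV₀ : ⊤ ≤ p ⁻¹ᵁ V₀ := by rw [chart_preimage_self hV₀ p hp]
  have e : (Spec (CommRingCat.of (R ⊗[k] Γ(X.left, V₀)))).basicOpen (p.appLE V₀ ⊤ hpV₀ f) =
      ⊤ ⊓ p ⁻¹ᵁ X.left.basicOpen f := Scheme.basicOpen_appLE p ⊤ V₀ hpV₀ f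
  rw [top_inf_eq, chart_appLE_self hV₀ p hp hpV₀] at e
  exact e.symm

/-! ## §2 The chart ring map is a map of `R ⊗_k Γ(V₀)`-algebras -/

include halg in
/-- Constants restrict (naturality of `constToPresheaf`, for the variable `k`-structures fixed by `halg`).
[cite: Hartshorne1977, II.8 p. 172] -/
private theorem algebraMap_eq_map_algebraMap' {V W : X.left.Opens} (h : W ≤ V) (s : k) :
    algebraMap k Γ(X.left, W) s = X.left.presheaf.map (homOfLE h).op (algebraMap k Γ(X.left, V) s) := by
  rw [halg, halg, ← CommRingCat.comp_apply, ← (constToPresheaf X).naturality (homOfLE h).op]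
  rfl

include hp in
/-- **`Λ_{O,V} (a ⊗ s|_V) = (a ⊗ s)|_O`** for all `a ⊗ s ∈ R ⊗_k Γ(V₀)`: the chart ring map is compatible with the algebra
maps from `R ⊗_k Γ(V₀)` (restriction of functions on the source, restriction to `O` on the target).
[cite: Hartshorne2010, Thm. 10.2 (proof), p. 81] [cite: AtiyahMacdonald1969, Ch. 2 (tensor product of algebras, pp. 30–31)] -/
theorem chartRingHom_comp_map {O : (Spec (CommRingCat.of (R ⊗[k] Γ(X.left, V₀)))).Opens} {V : X.left.Opens}
    (hV : V ≤ V₀) {hO : ⊤ ≤ (O.ι ≫ p) ⁻¹ᵁ V} {Λ : R ⊗[k] Γ(X.left, V) →+* Γ(↑O, ⊤)}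
    (h₁ : ∀ r : R, Λ (r ⊗ₜ 1) =
      O.ι.appTop ((Scheme.ΓSpecIso (CommRingCat.of (R ⊗[k] Γ(X.left, V₀)))).inv (r ⊗ₜ 1)))
    (h₂ : ∀ c : Γ(X.left, V), Λ (1 ⊗ₜ c) = (O.ι ≫ p).appLE V ⊤ hO c)
    {Φ : R ⊗[k] Γ(X.left, V₀) →+* R ⊗[k] Γ(X.left, V)}
    (hΦ : ∀ a s, Φ (a ⊗ₜ s) = a ⊗ₜ X.left.presheaf.map (homOfLE hV).op s) :
    Λ.comp Φ = O.ι.appTop.hom.comp (Scheme.ΓSpecIso (CommRingCat.of (R ⊗[k] Γ(X.left, V₀)))).inv.hom := by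
  refine ringHom_ext_tmul (fun r => ?_) (fun c => ?_)
  · rw [RingHom.comp_apply, hΦ, map_one, h₁]
    rfl
  · rw [RingHom.comp_apply, hΦ, chartRingHom_one_tmul_map hV₀ p hp hV h₂ c]
    rfl

/-! ## §3 Bijectivity over principal opens -/

/-- Sections of the open subscheme on a principal open of an affine scheme form the localization at the defining
function — transported along an equality of opens. [cite: Hartshorne1977, II Prop. 2.2 (b) (p. 71)] -/
private theorem isLocalization_away_restrict_of_eq {C : Scheme.{u}} [IsAffine C] (r : Γ(C, ⊤)) {O : C.Opens}
    (hO : O = C.basicOpen r) : IsLocalization.Away r Γ(↑O, ⊤) := by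
  subst hO
  exact AlgebraicGeometry.Γ_restrict_isLocalization C r


include halg hp in
set_option maxHeartbeats 400000 in -- sections of `Spec`: instance unification unfolds the structure sheaf
/-- **The chart ring map over a principal open is bijective.**  For `V = D(f) ⊆ V₀` (`f ∈ Γ(V₀)`) and `O = p⁻¹ V` the
characterised ring map `Λ_{O,V} : R ⊗_k Γ(V) → Γ(O)` is a bijection: the source is the localization of `R ⊗_k Γ(V₀)` at
`1 ⊗ f` (`Γ(V) = Γ(V₀)_f` for the affine `V₀`, and localization commutes with `R ⊗_k −`), the target `Γ(D(1 ⊗ f))` is the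
same localization (read through `Γ(Spec S, ⊤) ≅ S`), and `Λ` is compatible with the two structure maps
(`chartRingHom_comp_map`); surjectivity and injectivity are then the universal property of localization, element by element.
[cite: AtiyahMacdonald1969, Prop. 3.5] [cite: Hartshorne1977, II Prop. 2.2 (b) (p. 71)] [cite: GortzWedhorn2020, Prop. 4.20] -/
theorem chartRingHom_bijective (f : Γ(X.left, V₀)) {V : X.left.Opens} (hV : V = X.left.basicOpen f)
    {O : (Spec (CommRingCat.of (R ⊗[k] Γ(X.left, V₀)))).Opens} (hOV : O = p ⁻¹ᵁ V)
    {hO : ⊤ ≤ (O.ι ≫ p) ⁻¹ᵁ V} {Λ : R ⊗[k] Γ(X.left, V) →+* Γ(↑O, ⊤)}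
    (h₁ : ∀ r : R, Λ (r ⊗ₜ 1) =
      O.ι.appTop ((Scheme.ΓSpecIso (CommRingCat.of (R ⊗[k] Γ(X.left, V₀)))).inv (r ⊗ₜ 1)))
    (h₂ : ∀ c : Γ(X.left, V), Λ (1 ⊗ₜ c) = (O.ι ≫ p).appLE V ⊤ hO c) :
    Function.Bijective Λ := by
  have hVle : V ≤ V₀ := hV ▸ X.left.basicOpen_le f
  -- the source: `R ⊗_k Γ(V)` is the localization of `S := R ⊗_k Γ(V₀)` at (the image of) the powers of `f`
  letI algV : Algebra Γ(X.left, V₀) Γ(X.left, V) := (X.left.presheaf.map (homOfLE hVle).op).hom.toAlgebra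
  haveI : IsScalarTower k Γ(X.left, V₀) Γ(X.left, V) :=
    IsScalarTower.of_algebraMap_eq fun s => algebraMap_eq_map_algebraMap' halg hVle s
  haveI : IsLocalization.Away f Γ(X.left, V) := hV₀.isLocalization_of_eq_basicOpen f (homOfLE hVle) hV
  letI algD : Algebra (R ⊗[k] Γ(X.left, V₀)) (R ⊗[k] Γ(X.left, V)) :=
    (Algebra.TensorProduct.map (AlgHom.id k R) (IsScalarTower.toAlgHom k Γ(X.left, V₀) Γ(X.left, V))).toRingHom.toAlgebra
  have hD := SmoothAffineDeformation.isLocalization_baseChange (k := k) (B₀ := Γ(X.left, V₀)) (C₀ := Γ(X.left, V)) R f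
  -- `Λ ∘ algebraMap = (· |_O) ∘ ΓSpecIso⁻¹`
  have hcomp : Λ.comp (algebraMap (R ⊗[k] Γ(X.left, V₀)) (R ⊗[k] Γ(X.left, V))) =
      O.ι.appTop.hom.comp (Scheme.ΓSpecIso (CommRingCat.of (R ⊗[k] Γ(X.left, V₀)))).inv.hom :=
    chartRingHom_comp_map hV₀ p hp hVle h₁ h₂ fun a s => by
      change Algebra.TensorProduct.map (AlgHom.id k R) (IsScalarTower.toAlgHom k Γ(X.left, V₀) Γ(X.left, V)) (a ⊗ₜ s) = _
      rw [Algebra.TensorProduct.map_tmul]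
      rfl
  have hcomp' : ∀ x, Λ (algebraMap (R ⊗[k] Γ(X.left, V₀)) (R ⊗[k] Γ(X.left, V)) x) =
      O.ι.appTop ((Scheme.ΓSpecIso (CommRingCat.of (R ⊗[k] Γ(X.left, V₀)))).inv x) :=
    fun x => RingHom.congr_fun hcomp x
  -- the target: `Γ(O) = Γ(D(r₀))`, `r₀ := ΓSpecIso⁻¹ (1 ⊗ f)`, is the localization of `Γ(Spec S, ⊤)` at the powers of `r₀`
  have hO' : O = (Spec (CommRingCat.of (R ⊗[k] Γ(X.left, V₀)))).basicOpen
      ((Scheme.ΓSpecIso (CommRingCat.of (R ⊗[k] Γ(X.left, V₀)))).inv ((1 : R) ⊗ₜ f)) := by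
    rw [hOV, hV, preimage_basicOpen_chart hV₀ p hp f]
  haveI hT := isLocalization_away_restrict_of_eq
    ((Scheme.ΓSpecIso (CommRingCat.of (R ⊗[k] Γ(X.left, V₀)))).inv ((1 : R) ⊗ₜ f)) hO'
  -- the unit `u := algebraMap (1 ⊗ f)` of the source and its image
  haveI := hD
  have hu : IsUnit (algebraMap (R ⊗[k] Γ(X.left, V₀)) (R ⊗[k] Γ(X.left, V)) ((1 : R) ⊗ₜ f)) :=
    IsLocalization.map_units (M := (Submonoid.powers f).map
      (Algebra.TensorProduct.includeRight (R := k) (A := R) (B := Γ(X.left, V₀)))) (R ⊗[k] Γ(X.left, V))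
      ⟨(1 : R) ⊗ₜ f, Submonoid.mem_map_of_mem _ (Submonoid.mem_powers f)⟩
  refine ⟨fun z z' hzz' => ?_, fun y => ?_⟩
  · -- injective: write `z - z'` as `algebraMap x / (1 ⊗ f)^n`; then `x|_O = 0`, so `r₀^m x = 0` upstairs, so `x/1 = 0`
    have hd : Λ (z - z') = 0 := by rw [map_sub Λ, hzz', sub_self]
    refine sub_eq_zero.mp ?_
    obtain ⟨⟨x, ⟨_, ⟨_, ⟨n, rfl⟩, rfl⟩⟩⟩, hx⟩ := IsLocalization.surj ((Submonoid.powers f).map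
      (Algebra.TensorProduct.includeRight (R := k) (A := R) (B := Γ(X.left, V₀)))) (z - z')
    change (z - z') * algebraMap (R ⊗[k] Γ(X.left, V₀)) (R ⊗[k] Γ(X.left, V))
      (Algebra.TensorProduct.includeRight (f ^ n)) = algebraMap _ _ x at hx
    have h0 : O.ι.appTop
        ((Scheme.ΓSpecIso (CommRingCat.of (R ⊗[k] Γ(X.left, V₀)))).inv x) = 0 := by
      rw [← hcomp', ← hx, map_mul, hd, zero_mul]
    -- upstairs: `r₀^m · ΓSpecIso⁻¹ x = 0`
    have h0' := (IsLocalization.map_eq_zero_iff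
      (Submonoid.powers ((Scheme.ΓSpecIso (CommRingCat.of (R ⊗[k] Γ(X.left, V₀)))).inv ((1 : R) ⊗ₜ f)))
      Γ(↑O, ⊤) ((Scheme.ΓSpecIso (CommRingCat.of (R ⊗[k] Γ(X.left, V₀)))).inv x)).mp h0
    obtain ⟨⟨_, ⟨m, rfl⟩⟩, hm⟩ := h0'
    -- push down to `S` and then to the source
    have hm' : ((1 : R) ⊗ₜ[k] f) ^ m * x = 0 := by
      have e := congrArg (Scheme.ΓSpecIso (CommRingCat.of (R ⊗[k] Γ(X.left, V₀)))).hom hm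
      rw [map_mul, map_pow, map_zero, Iso.inv_hom_id_apply, Iso.inv_hom_id_apply] at e
      exact e
    have hx' : algebraMap (R ⊗[k] Γ(X.left, V₀)) (R ⊗[k] Γ(X.left, V)) x = 0 := by
      have e := congrArg (algebraMap (R ⊗[k] Γ(X.left, V₀)) (R ⊗[k] Γ(X.left, V))) hm'
      rw [map_mul, map_pow, map_zero] at e
      exact ((hu.pow m).mul_right_eq_zero).mp e
    rw [hx'] at hx
    have hfn : IsUnit (algebraMap (R ⊗[k] Γ(X.left, V₀)) (R ⊗[k] Γ(X.left, V))
        (Algebra.TensorProduct.includeRight (R := k) (A := R) (f ^ n))) := by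
      rw [map_pow, map_pow]
      exact hu.pow n
    exact (hfn.mul_left_eq_zero).mp hx
  · -- surjective: `y · r₀^n|_O = x|_O` upstairs, so `y = Λ (x/1 · u^{-n})`
    obtain ⟨⟨x, ⟨_, ⟨n, rfl⟩⟩⟩, hy⟩ := IsLocalization.surj
      (Submonoid.powers ((Scheme.ΓSpecIso (CommRingCat.of (R ⊗[k] Γ(X.left, V₀)))).inv ((1 : R) ⊗ₜ f))) y
    change y * O.ι.appTop
        (((Scheme.ΓSpecIso (CommRingCat.of (R ⊗[k] Γ(X.left, V₀)))).inv ((1 : R) ⊗ₜ f)) ^ n) =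
      O.ι.appTop x at hy
    obtain ⟨v, hv⟩ := (hu.pow n).exists_left_inv
    refine ⟨algebraMap (R ⊗[k] Γ(X.left, V₀)) (R ⊗[k] Γ(X.left, V))
      ((Scheme.ΓSpecIso (CommRingCat.of (R ⊗[k] Γ(X.left, V₀)))).hom x) * v, ?_⟩
    have e1 : Λ (algebraMap (R ⊗[k] Γ(X.left, V₀)) (R ⊗[k] Γ(X.left, V))
        ((Scheme.ΓSpecIso (CommRingCat.of (R ⊗[k] Γ(X.left, V₀)))).hom x)) =
        O.ι.appTop x := by
      rw [hcomp', Iso.hom_inv_id_apply]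
    have e2 : Λ (algebraMap (R ⊗[k] Γ(X.left, V₀)) (R ⊗[k] Γ(X.left, V)) (((1 : R) ⊗ₜ[k] f) ^ n)) =
        O.ι.appTop
          (((Scheme.ΓSpecIso (CommRingCat.of (R ⊗[k] Γ(X.left, V₀)))).inv ((1 : R) ⊗ₜ f)) ^ n) := by
      rw [hcomp', map_pow, map_pow]
    -- `y = y · Λ(u^n) · Λ(v) = Λ(x/1) · Λ(v)`
    have e3 : y * Λ (algebraMap (R ⊗[k] Γ(X.left, V₀)) (R ⊗[k] Γ(X.left, V)) (((1 : R) ⊗ₜ[k] f) ^ n)) *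
        Λ v = y := by
      rw [mul_assoc, ← map_mul, map_pow, mul_comm _ v, hv, map_one, mul_one]
    rw [map_mul, e1, ← hy, ← e2, e3]

end Literature.AlgebraicGeometry.Deformation

end
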